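import Mathlib
import Summits.Ventures.FusionMHD.Models.CerfonFreidbergIterLikeQHalfBoxes
import Summits.Ventures.FusionMHD.Models.FluxSurfacePolarRayTube
import HarnessLib

/-!
# Ventures/FusionMHD — Models/CerfonFreidbergIterLikeQHalfLink.lean: the PER-PANEL LINK from the kernel certificates to the TRUE
# flux surface `ψ_N = 1/2` of THE Cerfon–Freidberg ITER-like instance — tube around the approximant, unique ray crossing,
# and the bracket of the polar `(6.35)` integral over one `θ`-panel

HONEST FRAMING (LADDER-GRIDFUSION three columns; CF rung, F2 item R2).  Inputs (all in the tree): per panel `j` the Taylor-model facts of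
`Models/CerfonFreidbergIterLikeQHalfSound.lean` (`sound_of_ok`: integral segment of the polar integrand ALONG THE APPROXIMANT `m`, flux
residual `≤ eta/2⁶⁰`, `m`-range, `D_r(θ, m)`-range), the box facts of `Models/CerfonFreidbergIterLikeQHalfBoxes.lean` (`BoxData.sound`: flux below
the level on the core `s ≤ s_A`; `|∂_s D_r| ≤ M` on the strip `[s_A, s_max]`), the calculus of `Models/CerfonFreidbergIterLikeQHalfRay.lean`
(`HasDerivAt` of the ray profile and of `D_r`; joint continuity), and model-7's polar-ray glue (`Models/FluxSurfacePolarRayGlue.lean`: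
`rayRadius`, `rayRadius_spec`, `continuousOn_rayRadius`, `polarIntegrand`; `Models/FluxSurfacePolarRayTube.lean`: `signs_of_residual_of_slope`,
`panel_integral_envelope`).  Output, for a panel whose three data records pass their kernel obligations and the rational side conditions
`LinkData.check` (decided in the assembly file): on `Θ_j = [π·2jh, π·(2j+2)h]`
* the ray profile is strictly increasing on the strip, the surface `U = U(X_a,0)/2` is met EXACTLY ONCE on every ray (first crossing
  `ρ(θ) = rayRadius …`), inside the tube `|ρ(θ) − m(θ)| < r_j` (`r_j ≈ 3·eta/dlo ≈ 10⁻⁸`), `ρ` is continuous and `D_r(θ, ρ θ) > 0`;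
* (in the sequel `Models/CerfonFreidbergIterLikeQHalfPanel.lean`) **`panel_bracket`**: `Lo_j ≤ ∫_{Θ_j} ρ/((X_a + ρ cos θ)·D_r(θ, ρ)) dθ ≤ Hi_j`.
THIS FILE: §1 the objects (`u₀`, `Dfield`, `mθ`, `ρ`), §2 the per-panel link data `LinkData` and its decidable rational side conditions
`LinkData.check`, §3 the RELATIVE TUBE ENVELOPE (pure algebra): `(1 − ε)·m/(X_m D_m) ≤ s/(X_s D_s) ≤ κ⁺·m/(X_m D_m)` on the tube.
MODELLED: analytic Cerfon–Freidberg family; `q` of a MODEL surface — nothing about a device or stability.  No `decide` here.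
Typer/prover: gridfusion-model-5 (g7), 2026-08-27.  Citations: Freidberg 2014 §6.3.5 (6.35) [Freidberg2014].
-/

noncomputable section

open Set MeasureTheory intervalIntegral
open Literature.Analysis.ValidatedNumerics Literature.Analysis.ValidatedNumerics.PolyMP
open Literature.Analysis.ValidatedNumerics.NumericsMP Literature.Analysis.ValidatedNumerics.ExpPoly
open Literature.MathematicalPhysics.MHD Literature.MathematicalPhysics.MHD.CerfonFreidberg
open Summit.Ventures.FusionMHD.Models.PolarRay

namespace Summit.Ventures.FusionMHD.Models.CFIterLike.QHalf

/-! ## §1 Objects -/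

/-- The level of the surface `ψ_N = 1/2`: `u₀ = U(X_a, 0)/2`. -/
def u₀ : ℝ := 1 / 2 * U Xa 0

/-- The radial-derivative FIELD `D(θ, s) = D_r` at the ray point of radius `s` (closed form `Drc`). -/
def Dfield (θ s : ℝ) : ℝ := Drc coeff Xa s θ

/-- THE APPROXIMANT in the polar angle: `m(θ) = mA(θ/π)`. -/
def mθ (θ : ℝ) : ℝ := mA (θ / Real.pi)

/-- THE RAY RADIUS of the surface `U = u₀` about the magnetic axis (model-7's glued least root). -/
def ρ (θ : ℝ) : ℝ := rayRadius U Xa 0 u₀ θ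

/-- Mathlib's lower rational bound of `π` (20 digits). -/
def piLoQ : ℚ := 3.14159265358979323846
/-- Mathlib's upper rational bound of `π` (20 digits). -/
def piHiQ : ℚ := 3.14159265358979323847
/-- Lower rational bound of `X_a` (`CFIterLike.Xa_bounds`). -/
def XaLoQ : ℚ := 104543964 / 100000000

/-! ## §2 Per-panel link data and its rational side conditions -/

/-- Per-panel link constants: tube radius `r`, strip slope bounds `lam ≤ D_r ≤ dtop`, relative envelope `(1 − eps, kplus)`, and the
final bracket `[Lo, Hi]` of the panel integral. -/
structure LinkData where
  /-- panel index -/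
  j : ℕ
  /-- tube radius -/
  r : ℚ
  /-- lower bound of `D_r` on the strip -/
  lam : ℚ
  /-- upper bound of `D_r` on the strip -/
  dtop : ℚ
  /-- relative lower envelope deficit -/
  eps : ℚ
  /-- relative upper envelope factor -/
  kplus : ℚ
  /-- claimed lower bound of the panel integral -/
  Lo : ℚ
  /-- claimed upper bound of the panel integral -/
  Hi : ℚ

/-- THE RATIONAL SIDE CONDITIONS linking a panel certificate `d`, its box data `b` and the link constants `ℓ` (decided per panel). -/
def LinkData.check (ℓ : LinkData) (d : PanelCert) (b : BoxData) : Bool :=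
  decide (b.j = d.j) && decide (ℓ.j = d.j)
  && decide (b.thlo ≤ piLoQ * panelLeft hw d.j) && decide (piHiQ * panelLeft hw (d.j + 1) ≤ b.thhi)
  && decide (0 < b.sA) && decide (b.sA + ℓ.r ≤ (d.mlo : ℚ) / tmS) && decide ((d.mhi : ℚ) / tmS + ℓ.r ≤ b.smax)
  && decide (0 < ℓ.r) && decide ((d.eta : ℚ) / tmS < ℓ.r * ((d.dlo : ℚ) / tmS - b.M * ℓ.r))
  && decide (0 < ℓ.lam) && decide (ℓ.lam + b.M * ((d.mhi : ℚ) / tmS - b.sA) ≤ (d.dlo : ℚ) / tmS)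
  && decide (ℓ.lam + b.M * (b.smax - (d.mlo : ℚ) / tmS) ≤ (d.dlo : ℚ) / tmS)
  && decide ((d.dhi : ℚ) / tmS + b.M * ((d.mhi : ℚ) / tmS - b.sA) ≤ ℓ.dtop)
  && decide ((d.dhi : ℚ) / tmS + b.M * (b.smax - (d.mlo : ℚ) / tmS) ≤ ℓ.dtop)
  && decide (0 ≤ b.M) && decide (0 < d.mlo) && decide (0 < d.dlo) && decide (0 ≤ d.plo) && decide (0 < b.kap)
  && decide (ℓ.r / ((d.mlo : ℚ) / tmS) + ℓ.r / (XaLoQ - b.smax) + b.M * ℓ.r / ((d.dlo : ℚ) / tmS) ≤ ℓ.eps) && decide (ℓ.eps ≤ 1)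
  && decide (ℓ.r < XaLoQ - b.smax) && decide (b.M * ℓ.r < (d.dlo : ℚ) / tmS)
  && decide (1 + ℓ.r / ((d.mlo : ℚ) / tmS) ≤ ℓ.kplus * (1 - ℓ.r / (XaLoQ - b.smax)) * (1 - b.M * ℓ.r / ((d.dlo : ℚ) / tmS)))
  && decide (ℓ.Lo ≤ (1 - ℓ.eps) * ((d.plo : ℚ) / tmS)) && decide (ℓ.kplus * ((d.phi : ℚ) / tmS) ≤ ℓ.Hi)

/-! ## §3 The relative tube envelope (pure algebra) -/

/-- For `a, b, c ∈ [0, 1]`: `(1 − a)(1 − b)(1 − c) ≥ 1 − a − b − c`. -/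
theorem one_sub_mul_three {a b c : ℝ} (ha : 0 ≤ a) (hb : 0 ≤ b) (hc : 0 ≤ c) (hc1 : c ≤ 1) :
    1 - a - b - c ≤ (1 - a) * (1 - b) * (1 - c) := by
  nlinarith [mul_nonneg (mul_nonneg ha hb) (sub_nonneg.2 hc1), mul_nonneg ha hc, mul_nonneg hb hc]

/-- **THE RELATIVE ENVELOPE.**  If `|s − m| ≤ r`, `|X_s − X_m| ≤ r`, `|D_s − D_m| ≤ M r` with `m ≥ mlo > r`, `X_m ≥ Xlo > r`,
`D_m ≥ Dlo > M r`, then `(1 − ε)·m/(X_m D_m) ≤ s/(X_s D_s) ≤ κ⁺·m/(X_m D_m)` for any `ε ≥ r/mlo + r/Xlo + Mr/Dlo` and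
`κ⁺` with `1 + r/mlo ≤ κ⁺ (1 − r/Xlo)(1 − Mr/Dlo)`. -/
theorem envelope {m r Xm Dm M s Xs Ds mlo Xlo Dlo eps kplus : ℝ}
    (hr : 0 < r) (hmlo : 0 < mlo) (hXlo : 0 < Xlo) (hDlo : 0 < Dlo) (hM : 0 ≤ M)
    (hm : mlo ≤ m) (hX : Xlo ≤ Xm) (hD : Dlo ≤ Dm)
    (hs : |s - m| ≤ r) (hXs : |Xs - Xm| ≤ r) (hDs : |Ds - Dm| ≤ M * r)
    (h1 : r < mlo) (h2 : r < Xlo) (h3 : M * r < Dlo)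
    (heps : r / mlo + r / Xlo + M * r / Dlo ≤ eps) (heps1 : eps ≤ 1)
    (hk : 1 + r / mlo ≤ kplus * (1 - r / Xlo) * (1 - M * r / Dlo)) :
    (1 - eps) * (m / (Xm * Dm)) ≤ s / (Xs * Ds) ∧ s / (Xs * Ds) ≤ kplus * (m / (Xm * Dm)) := by
  have hs' := abs_le.1 hs; have hXs' := abs_le.1 hXs; have hDs' := abs_le.1 hDs
  have hm0 : 0 < m := hmlo.trans_le hm
  have hXm0 : 0 < Xm := hXlo.trans_le hX
  have hDm0 : 0 < Dm := hDlo.trans_le hD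
  have hs0 : 0 < s := by linarith
  have hXs0 : 0 < Xs := by linarith
  have hMr : 0 ≤ M * r := mul_nonneg hM hr.le
  have hDs0 : 0 < Ds := by linarith
  -- the three ratios
  set a := r / mlo with ha
  set b := r / Xlo with hb
  set c := M * r / Dlo with hc
  have ha0 : 0 ≤ a := div_nonneg hr.le hmlo.le
  have hb0 : 0 ≤ b := div_nonneg hr.le hXlo.le
  have hc0 : 0 ≤ c := div_nonneg hMr hDlo.le
  have ha1 : a < 1 := (div_lt_one hmlo).2 h1
  have hb1 : b < 1 := (div_lt_one hXlo).2 h2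
  have hc1 : c < 1 := (div_lt_one hDlo).2 h3
  -- ratio 1: s/m ∈ [1 - a, 1 + a]
  have hrm : r / m ≤ a := by rw [ha]; exact div_le_div_of_nonneg_left hr.le hmlo hm
  have q1lo : 1 - a ≤ s / m := by
    rw [le_div_iff₀ hm0]
    have : (1 - r / m) * m = m - r := by field_simp
    nlinarith [this, hrm]
  have q1hi : s / m ≤ 1 + a := by
    rw [div_le_iff₀ hm0]
    have : (1 + r / m) * m = m + r := by field_simp
    nlinarith [this, hrm]
  -- ratio 2: Xm/Xs ∈ [1 - b, 1/(1 - b)]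
  have hrX : r / Xm ≤ b := by rw [hb]; exact div_le_div_of_nonneg_left hr.le hXlo hX
  have q2lo : 1 - b ≤ Xm / Xs := by
    rw [le_div_iff₀ hXs0]
    have e : (1 - r / Xm) * (Xm + r) ≤ Xm := by
      have : (1 - r / Xm) * (Xm + r) = Xm - r * r / Xm := by field_simp; ring
      rw [this]; have : 0 ≤ r * r / Xm := by positivity
      linarith
    have hb1' : 0 ≤ 1 - b := by linarith
    calc (1 - b) * Xs ≤ (1 - b) * (Xm + r) := by apply mul_le_mul_of_nonneg_left (by linarith) hb1'
      _ ≤ (1 - r / Xm) * (Xm + r) := by apply mul_le_mul_of_nonneg_right (by linarith) (by linarith)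
      _ ≤ Xm := e
  have q2hi : Xm / Xs ≤ 1 / (1 - b) := by
    rw [div_le_div_iff₀ hXs0 (by linarith), one_mul]
    have : Xm * (1 - r / Xm) = Xm - r := by field_simp
    calc Xm * (1 - b) ≤ Xm * (1 - r / Xm) := by apply mul_le_mul_of_nonneg_left (by linarith) hXm0.le
      _ = Xm - r := this
      _ ≤ Xs := by linarith
  -- ratio 3: Dm/Ds ∈ [1 - c, 1/(1 - c)]
  have hrD : M * r / Dm ≤ c := by rw [hc]; exact div_le_div_of_nonneg_left hMr hDlo hD
  have q3lo : 1 - c ≤ Dm / Ds := by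
    rw [le_div_iff₀ hDs0]
    have e : (1 - M * r / Dm) * (Dm + M * r) ≤ Dm := by
      have : (1 - M * r / Dm) * (Dm + M * r) = Dm - (M * r) * (M * r) / Dm := by field_simp; ring
      rw [this]; have : 0 ≤ (M * r) * (M * r) / Dm := by positivity
      linarith
    have hc1' : 0 ≤ 1 - c := by linarith
    calc (1 - c) * Ds ≤ (1 - c) * (Dm + M * r) := by apply mul_le_mul_of_nonneg_left (by linarith) hc1'
      _ ≤ (1 - M * r / Dm) * (Dm + M * r) := by apply mul_le_mul_of_nonneg_right (by linarith) (by linarith)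
      _ ≤ Dm := e
  have q3hi : Dm / Ds ≤ 1 / (1 - c) := by
    rw [div_le_div_iff₀ hDs0 (by linarith), one_mul]
    have : Dm * (1 - M * r / Dm) = Dm - M * r := by field_simp
    calc Dm * (1 - c) ≤ Dm * (1 - M * r / Dm) := by apply mul_le_mul_of_nonneg_left (by linarith) hDm0.le
      _ = Dm - M * r := this
      _ ≤ Ds := by linarith
  -- factorisation
  have key : s / (Xs * Ds) = m / (Xm * Dm) * (s / m * (Xm / Xs) * (Dm / Ds)) := by
    field_simp
  have hP0 : 0 < m / (Xm * Dm) := by positivity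
  rw [key]
  constructor
  · rw [mul_comm (1 - eps)]
    apply mul_le_mul_of_nonneg_left _ hP0.le
    have h3 := one_sub_mul_three ha0 hb0 hc0 hc1.le
    have hprod : (1 - a) * (1 - b) * (1 - c) ≤ s / m * (Xm / Xs) * (Dm / Ds) := by
      apply mul_le_mul (mul_le_mul q1lo q2lo (by linarith) (le_trans (by linarith) q1lo)) q3lo (by linarith)
      exact le_trans (mul_nonneg (by linarith) (by linarith)) (mul_le_mul q1lo q2lo (by linarith) (le_trans (by linarith) q1lo))
    linarith
  · rw [mul_comm kplus]
    apply mul_le_mul_of_nonneg_left _ hP0.le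
    have hXX : 0 ≤ Xm / Xs := by positivity
    have hDD : 0 ≤ Dm / Ds := by positivity
    have hsm : 0 ≤ s / m := by positivity
    have hub : s / m * (Xm / Xs) * (Dm / Ds) ≤ (1 + a) * (1 / (1 - b)) * (1 / (1 - c)) := by
      apply mul_le_mul (mul_le_mul q1hi q2hi hXX (by linarith)) q3hi hDD
      exact mul_nonneg (by linarith) (by positivity)
    have hk' : (1 + a) * (1 / (1 - b)) * (1 / (1 - c)) ≤ kplus := by
      rw [mul_one_div, mul_one_div, div_div, div_le_iff₀ (mul_pos (by linarith) (by linarith))]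
      calc 1 + a ≤ kplus * (1 - b) * (1 - c) := hk
        _ = kplus * ((1 - b) * (1 - c)) := by ring
    linarith

end Summit.Ventures.FusionMHD.Models.CFIterLike.QHalf

end
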